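import Mathlib.Analysis.SpecialFunctions.SmoothTransition
import Mathlib.Analysis.SpecialFunctions.Log.Basic
import Mathlib.Analysis.Calculus.ContDiff.Deriv
import Mathlib.Analysis.Calculus.Deriv.MeanValue
import Mathlib.Analysis.Calculus.Deriv.Slope
import Mathlib.MeasureTheory.Integral.IntervalIntegral.FundThmCalculus
import HarnessLib

/-!
# The warping profiles of the Gromov–Thurston `2π` smoothing

Support file (everything proved; no named fact, no `sorry`) for the Gromov–Thurston `2π` theorem
`Literature.Geometry.Riemannian.gromovThurston_twoPi_four` (`CuspedHyperbolic.lean`; Anderson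
2006, §2.1, (2.4): "one forms the Euclidean cone of length `1` on `σ`, and takes the constant skew
product with the flat metric on `T^{n-2}` … A natural smoothing of this cone singularity gives a
metric of non-positive curvature on `M_σ`"; Bleiler–Hodgson 1996, Thm. 9, for the warped-product
smoothing in dimension `3`).

In straightened cusp coordinates `(y₀, y₁, y₂, t)` (the slope along `y₂`, the cusp end `t → +∞`)
the hyperbolic cusp metric is `e^{-2t}(dy₀² + dy₁² + dy₂²) + dt²`. The smoothed metric is the
one-variable diagonal model `c₀(t) dy₀² + c₁(t) dy₁² + c₂(t) dy₂² + c₃(t) dt²` of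
`OneVariableDiagonalMetric.lean`, with

* `c = hyperbolic` for `t ≤ a` (so that it glues to the hyperbolic metric of the thick part);
* `c₀ = c₁ = κ²`, `c₂ = λ² m² e^{-2t}`, `c₃ = λ² e^{-2t}` for `t ≥ T`, `m = 2π / L` — in the polar
  coordinate `r = e^{-t}` of the filling disc this is the FLAT metric
  `λ²(dr² + r²(m dy₂)²) + κ²(dy₀² + dy₁²)` with cone angle exactly `2π` in the angle
  `θ₃ = 2π y₂ / L = m y₂` of period `2π` (the slope has flat length `L`), i.e. a smooth flat
  `D² × T²` near the core torus;
* everywhere the convexity / monotonicity conditions of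
  `curvatureForm_oneVarMetric_nonpos` (nonpositive sectional curvature).

Construction (this file): in arclength `s` (`ds = √c₃ dt`) the model is the multiply warped
product `ds² + p(s)²(dy₀² + dy₁²) + q(s)² dy₂²`; we take `p, q` convex non-increasing with
`p = q = e^{-s}` for `s ≤ a`, `p ≡ κ` and `q` affine of slope `-m` for `s ≥ a/2` (possible iff
`m ≤ e^{-s}` on the transition region, i.e. because `L ≥ 2π` and `a < 0`: the cone angle of the
enlarged cusp `L e^{-a/2} > 2π`), and a reparametrisation `s(t)` with `s = t` for `t ≤ a` and
`s = s_* - λ e^{-t}` for `t ≥ a/2`, `s_*` the zero of `q` (the cone tip), `λ > 0` adjusted so that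
the ends meet. The derivatives `p', q', s'` are explicit smooth functions built from Mathlib's
`Real.smoothTransition`; `p, q, s` are their primitives (`intervalIntegral`, FTC).

## Main result

* `TwoPiProfile.exists_profile` — for `a < 0` and `2π ≤ L` there are smooth positive
  `c : Fin 4 → ℝ → ℝ` and constants `κ, λ > 0`, `T` with the three properties above, the
  curvature conditions being stated verbatim in the form consumed by
  `Literature.Geometry.Riemannian.curvatureForm_oneVarMetric_nonpos`.

## References

* M. T. Anderson, *Dehn filling and Einstein metrics in higher dimensions*, J. Differential Geom.
  73 (2006) 219–261, §2.1. [Anderson2006]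
* S. A. Bleiler, C. D. Hodgson, *Spherical space forms and Dehn filling*, Topology 35 (1996)
  809–833, Thm. 9 and its proof (the metrics `dr² + f(r)² dμ² + g(r)² dλ²`). [BleilerHodgson1996]
* B. O'Neill, *Semi-Riemannian geometry* (1983), Ch. 7, Prop. 7.42. [ONeill1983]
-/

noncomputable section

open Set Real intervalIntegral MeasureTheory
open scoped ContDiff

namespace Literature.Geometry.Riemannian

namespace TwoPiProfile

/-! ### Primitives of smooth functions -/

/-- The primitive `x ↦ ∫_b^x f` of a continuous function has derivative `f`. [folklore] -/
theorem hasDerivAt_primitive {f : ℝ → ℝ} (hf : Continuous f) (b x : ℝ) :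
    HasDerivAt (fun x ↦ ∫ u in b..x, f u) (f x) x :=
  (hf.integral_hasStrictDerivAt b x).hasDerivAt

/-- The derivative of the primitive of a continuous function is the function. [folklore] -/
theorem deriv_primitive {f : ℝ → ℝ} (hf : Continuous f) (b : ℝ) :
    deriv (fun x ↦ ∫ u in b..x, f u) = f :=
  funext fun x ↦ (hasDerivAt_primitive hf b x).deriv

/-- The primitive of a smooth function is smooth. [folklore] -/
theorem contDiff_primitive {f : ℝ → ℝ} (hf : ContDiff ℝ ∞ f) (b : ℝ) :
    ContDiff ℝ ∞ (fun x ↦ ∫ u in b..x, f u) := by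
  rw [contDiff_infty_iff_deriv, deriv_primitive hf.continuous b]
  exact ⟨fun x ↦ (hasDerivAt_primitive hf.continuous b x).differentiableAt, hf⟩

/-! ### The cutoff -/

/-- The **cutoff** `φ_a(x) = 1 - smoothTransition ((x - a) / (-a/2))`: for `a < 0` a smooth
non-increasing function equal to `1` on `x ≤ a` and to `0` on `x ≥ a/2`. [folklore] -/
def cutoff (a x : ℝ) : ℝ := 1 - smoothTransition ((x - a) / (-a / 2))

/-- The cutoff is smooth. [folklore] -/
theorem contDiff_cutoff (a : ℝ) : ContDiff ℝ ∞ (cutoff a) :=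
  contDiff_const.sub
    (Real.smoothTransition.contDiff.comp ((contDiff_id.sub contDiff_const).div_const _))

/-- The cutoff is continuous. [folklore] -/
theorem continuous_cutoff (a : ℝ) : Continuous (cutoff a) := (contDiff_cutoff a).continuous

/-- The cutoff equals `1` to the left of `a`. [folklore] -/
theorem cutoff_of_le {a x : ℝ} (ha : a < 0) (hx : x ≤ a) : cutoff a x = 1 := by
  have h : (x - a) / (-a / 2) ≤ 0 :=
    div_nonpos_of_nonpos_of_nonneg (sub_nonpos.2 hx) (by linarith)
  simp [cutoff, smoothTransition.zero_of_nonpos h]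

/-- The cutoff vanishes to the right of `a/2`. [folklore] -/
theorem cutoff_of_ge {a x : ℝ} (ha : a < 0) (hx : a / 2 ≤ x) : cutoff a x = 0 := by
  have hpos : 0 < -a / 2 := by linarith
  have h : 1 ≤ (x - a) / (-a / 2) := by
    rw [le_div_iff₀ hpos]
    linarith
  simp [cutoff, smoothTransition.one_of_one_le h]

/-- `0 ≤ φ`. [folklore] -/
theorem cutoff_nonneg (a x : ℝ) : 0 ≤ cutoff a x := by
  have := smoothTransition.le_one ((x - a) / (-a / 2))
  simp only [cutoff]
  linarith

/-- `φ ≤ 1`. [folklore] -/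
theorem cutoff_le_one (a x : ℝ) : cutoff a x ≤ 1 := by
  have := smoothTransition.nonneg ((x - a) / (-a / 2))
  simp only [cutoff]
  linarith

/-- The cutoff is non-increasing (for `a < 0`). [folklore] -/
theorem antitone_cutoff {a : ℝ} (ha : a < 0) : Antitone (cutoff a) := by
  intro x y hxy
  have hpos : 0 < -a / 2 := by linarith
  have h : (x - a) / (-a / 2) ≤ (y - a) / (-a / 2) :=
    div_le_div_of_nonneg_right (by linarith) hpos.le
  have := smoothTransition.monotone h
  simp only [cutoff]
  linarith

/-- The derivative of the cutoff is non-positive. [folklore] -/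
theorem deriv_cutoff_nonpos {a : ℝ} (ha : a < 0) (x : ℝ) : deriv (cutoff a) x ≤ 0 :=
  (antitone_cutoff ha).deriv_nonpos

/-- The derivative of the cutoff vanishes to the right of `a/2` (where it is constant). [folklore] -/
theorem deriv_cutoff_of_gt {a x : ℝ} (ha : a < 0) (hx : a / 2 < x) : deriv (cutoff a) x = 0 := by
  have h : cutoff a =ᶠ[nhds x] fun _ ↦ (0 : ℝ) := by
    filter_upwards [Ioi_mem_nhds hx] with y hy
    exact cutoff_of_ge ha (le_of_lt hy)
  rw [h.deriv_eq]
  exact deriv_const x 0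

/-- The cutoff has a derivative (it is smooth). [folklore] -/
theorem hasDerivAt_cutoff (a x : ℝ) : HasDerivAt (cutoff a) (deriv (cutoff a) x) x :=
  (((contDiff_cutoff a).differentiable (by simp)).differentiableAt).hasDerivAt

/-! ### The explicit derivatives `p'`, `q'`, `s'` -/

/-- `p'(x) = -φ(x) e^{-x}`: the derivative of the warping function of the `T²`-directions. [folklore] -/
def dp (a x : ℝ) : ℝ := -(cutoff a x * exp (-x))

/-- `q'(x) = -(φ(x) e^{-x} + (1 - φ(x)) m)`: the derivative of the warping function of the slope
direction, interpolating between `-e^{-x}` and the constant slope `-m` of the cone. [folklore] -/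
def dq (a m x : ℝ) : ℝ := -(cutoff a x * exp (-x) + (1 - cutoff a x) * m)

/-- `s'(t) = φ(t) + (1 - φ(t)) λ e^{-t}`: the derivative of the arclength reparametrisation. [folklore] -/
def ds (a lam t : ℝ) : ℝ := cutoff a t + (1 - cutoff a t) * (lam * exp (-t))

/-- `p'` is smooth. [folklore] -/
theorem contDiff_dp (a : ℝ) : ContDiff ℝ ∞ (dp a) :=
  ((contDiff_cutoff a).mul (contDiff_neg.exp)).neg

/-- `q'` is smooth. [folklore] -/
theorem contDiff_dq (a m : ℝ) : ContDiff ℝ ∞ (dq a m) :=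
  (((contDiff_cutoff a).mul contDiff_neg.exp).add
    ((contDiff_const.sub (contDiff_cutoff a)).mul contDiff_const)).neg

/-- `s'` is smooth. [folklore] -/
theorem contDiff_ds (a lam : ℝ) : ContDiff ℝ ∞ (ds a lam) :=
  (contDiff_cutoff a).add
    ((contDiff_const.sub (contDiff_cutoff a)).mul (contDiff_const.mul contDiff_neg.exp))

/-- `p' ≤ 0`. [folklore] -/
theorem dp_nonpos (a x : ℝ) : dp a x ≤ 0 := by
  have := mul_nonneg (cutoff_nonneg a x) (exp_pos (-x)).le
  simp only [dp]
  linarith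

/-- `q' < 0` (for `m > 0`). [folklore] -/
theorem dq_neg {a m : ℝ} (hm : 0 < m) (x : ℝ) : dq a m x < 0 := by
  simp only [dq, neg_lt_zero]
  have h0 := cutoff_nonneg a x
  have h1 := cutoff_le_one a x
  rcases eq_or_lt_of_le h1 with h | h
  · rw [h]; simp [exp_pos]
  · have : 0 < (1 - cutoff a x) * m := mul_pos (by linarith) hm
    have : 0 ≤ cutoff a x * exp (-x) := mul_nonneg h0 (exp_pos _).le
    linarith

/-- `q' ≤ 0`. [folklore] -/
theorem dq_nonpos {a m : ℝ} (hm : 0 < m) (x : ℝ) : dq a m x ≤ 0 := (dq_neg hm x).le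

/-- `s' > 0` (for `λ > 0`): a convex combination of `1` and `λ e^{-t} > 0`. [folklore] -/
theorem ds_pos {a lam : ℝ} (hlam : 0 < lam) (t : ℝ) : 0 < ds a lam t := by
  simp only [ds]
  have h0 := cutoff_nonneg a t
  have h1 := cutoff_le_one a t
  have he : 0 < lam * exp (-t) := mul_pos hlam (exp_pos _)
  rcases eq_or_lt_of_le h0 with h | h
  · rw [← h]; simpa using he
  · have : 0 ≤ (1 - cutoff a t) * (lam * exp (-t)) := mul_nonneg (by linarith) he.le
    linarith

/-- To the left of `a`: `p'(x) = -e^{-x}`. [folklore] -/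
theorem dp_of_le {a x : ℝ} (ha : a < 0) (hx : x ≤ a) : dp a x = -exp (-x) := by
  simp [dp, cutoff_of_le ha hx]

/-- To the left of `a`: `q'(x) = -e^{-x}`. [folklore] -/
theorem dq_of_le {a m x : ℝ} (ha : a < 0) (hx : x ≤ a) : dq a m x = -exp (-x) := by
  simp [dq, cutoff_of_le ha hx]

/-- To the left of `a`: `s'(t) = 1`. [folklore] -/
theorem ds_of_le {a lam t : ℝ} (ha : a < 0) (ht : t ≤ a) : ds a lam t = 1 := by
  simp [ds, cutoff_of_le ha ht]

/-- To the right of `a/2`: `p'(x) = 0`. [folklore] -/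
theorem dp_of_ge {a x : ℝ} (ha : a < 0) (hx : a / 2 ≤ x) : dp a x = 0 := by
  simp [dp, cutoff_of_ge ha hx]

/-- To the right of `a/2`: `q'(x) = -m`. [folklore] -/
theorem dq_of_ge {a m x : ℝ} (ha : a < 0) (hx : a / 2 ≤ x) : dq a m x = -m := by
  simp [dq, cutoff_of_ge ha hx]

/-- To the right of `a/2`: `s'(t) = λ e^{-t}`. [folklore] -/
theorem ds_of_ge {a lam t : ℝ} (ha : a < 0) (ht : a / 2 ≤ t) : ds a lam t = lam * exp (-t) := by
  simp [ds, cutoff_of_ge ha ht]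

/-- On the transition region and to its left (`x ≤ a/2 < 0`), `m ≤ 1 ≤ e^{-x}` gives
`q'(x) ≥ -e^{-x}`. [folklore] -/
theorem neg_exp_le_dq {a m x : ℝ} (ha : a < 0) (hm1 : m ≤ 1) (hx : x ≤ a / 2) :
    -exp (-x) ≤ dq a m x := by
  have hmx : m ≤ exp (-x) := hm1.trans (by
    have : 0 ≤ -x := by linarith
    simpa using (one_le_exp this))
  have h1 := cutoff_le_one a x
  simp only [dq, neg_le_neg_iff]
  nlinarith

/-- `p'(x) ≥ -e^{-x}`. [folklore] -/
theorem neg_exp_le_dp (a x : ℝ) : -exp (-x) ≤ dp a x := by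
  have h1 := cutoff_le_one a x
  have := exp_pos (-x)
  simp only [dp, neg_le_neg_iff]
  nlinarith

/-! ### The warping functions `p`, `q` and the reparametrisation `s` -/

/-- `p(x) = e^{-a} + ∫_a^x p'`. [folklore] -/
def p (a x : ℝ) : ℝ := exp (-a) + ∫ u in a..x, dp a u

/-- `q(x) = e^{-a} + ∫_a^x q'`. [folklore] -/
def q (a m x : ℝ) : ℝ := exp (-a) + ∫ u in a..x, dq a m u

/-- `s(t) = a + ∫_a^t s'`. [folklore] -/
def sfun (a lam t : ℝ) : ℝ := a + ∫ u in a..t, ds a lam u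

/-- `p` has derivative `p'`. [folklore] -/
theorem hasDerivAt_p (a x : ℝ) : HasDerivAt (p a) (dp a x) x :=
  (hasDerivAt_primitive (contDiff_dp a).continuous a x).const_add _

/-- `q` has derivative `q'`. [folklore] -/
theorem hasDerivAt_q (a m x : ℝ) : HasDerivAt (q a m) (dq a m x) x :=
  (hasDerivAt_primitive (contDiff_dq a m).continuous a x).const_add _

/-- `s` has derivative `s'`. [folklore] -/
theorem hasDerivAt_sfun (a lam t : ℝ) : HasDerivAt (sfun a lam) (ds a lam t) t :=
  (hasDerivAt_primitive (contDiff_ds a lam).continuous a t).const_add _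

/-- `p` is smooth. [folklore] -/
theorem contDiff_p (a : ℝ) : ContDiff ℝ ∞ (p a) :=
  contDiff_const.add (contDiff_primitive (contDiff_dp a) a)

/-- `q` is smooth. [folklore] -/
theorem contDiff_q (a m : ℝ) : ContDiff ℝ ∞ (q a m) :=
  contDiff_const.add (contDiff_primitive (contDiff_dq a m) a)

/-- `s` is smooth. [folklore] -/
theorem contDiff_sfun (a lam : ℝ) : ContDiff ℝ ∞ (sfun a lam) :=
  contDiff_const.add (contDiff_primitive (contDiff_ds a lam) a)

/-- `p` is non-increasing. [folklore] -/
theorem antitone_p (a : ℝ) : Antitone (p a) :=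
  antitone_of_deriv_nonpos (fun x ↦ (hasDerivAt_p a x).differentiableAt) fun x ↦ by
    rw [(hasDerivAt_p a x).deriv]; exact dp_nonpos a x

/-- `q` is strictly decreasing (for `m > 0`). [folklore] -/
theorem strictAnti_q {a m : ℝ} (hm : 0 < m) : StrictAnti (q a m) :=
  strictAnti_of_deriv_neg fun x ↦ by rw [(hasDerivAt_q a m x).deriv]; exact dq_neg hm x

/-- `s` is strictly increasing (for `λ > 0`). [folklore] -/
theorem strictMono_sfun {a lam : ℝ} (hlam : 0 < lam) : StrictMono (sfun a lam) :=
  strictMono_of_deriv_pos fun t ↦ by rw [(hasDerivAt_sfun a lam t).deriv]; exact ds_pos hlam t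

/-- `∫_a^x (-e^{-u}) du = e^{-x} - e^{-a}`. [folklore] -/
theorem integral_neg_exp_neg (a x : ℝ) : ∫ u in a..x, -exp (-u) = exp (-x) - exp (-a) := by
  have h : ∀ u ∈ uIcc a x, HasDerivAt (fun u ↦ exp (-u)) (-exp (-u)) u := fun u _ ↦ by
    simpa using ((hasDerivAt_neg u).exp)
  rw [integral_eq_sub_of_hasDerivAt h]
  exact (continuous_neg.rexp.neg).intervalIntegrable a x

/-- To the left of `a`: `p(x) = e^{-x}`. [folklore] -/
theorem p_of_le {a x : ℝ} (ha : a < 0) (hx : x ≤ a) : p a x = exp (-x) := by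
  have h : ∫ u in a..x, dp a u = ∫ u in a..x, -exp (-u) := by
    refine integral_congr fun u hu ↦ ?_
    rw [uIcc_of_ge hx] at hu
    exact dp_of_le ha hu.2
  rw [p, h, integral_neg_exp_neg]
  ring

/-- To the left of `a`: `q(x) = e^{-x}`. [folklore] -/
theorem q_of_le {a m x : ℝ} (ha : a < 0) (hx : x ≤ a) : q a m x = exp (-x) := by
  have h : ∫ u in a..x, dq a m u = ∫ u in a..x, -exp (-u) := by
    refine integral_congr fun u hu ↦ ?_
    rw [uIcc_of_ge hx] at hu
    exact dq_of_le ha hu.2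
  rw [q, h, integral_neg_exp_neg]
  ring

/-- To the left of `a`: `s(t) = t`. [folklore] -/
theorem sfun_of_le {a lam t : ℝ} (ha : a < 0) (ht : t ≤ a) : sfun a lam t = t := by
  have h : ∫ u in a..t, ds a lam u = ∫ u in a..t, (1 : ℝ) := by
    refine integral_congr fun u hu ↦ ?_
    rw [uIcc_of_ge ht] at hu
    exact ds_of_le ha hu.2
  rw [sfun, h, intervalIntegral.integral_const]
  simp

/-- To the right of `a/2`: `p(x) = p(a/2)` (the constant `κ`). [folklore] -/
theorem p_of_ge {a x : ℝ} (ha : a < 0) (hx : a / 2 ≤ x) : p a x = p a (a / 2) := by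
  have hint : ∀ b c, IntervalIntegrable (dp a) volume b c := fun b c ↦
    (contDiff_dp a).continuous.intervalIntegrable b c
  have h0 : ∫ u in (a / 2)..x, dp a u = 0 := by
    rw [← integral_zero (a := a / 2) (b := x)]
    refine integral_congr fun u hu ↦ ?_
    rw [uIcc_of_le hx] at hu
    exact dp_of_ge ha hu.1
  simp only [p]
  rw [← integral_add_adjacent_intervals (hint a (a / 2)) (hint (a / 2) x), h0, add_zero]

/-- To the right of `a/2`: `q(x) = q(a/2) - m (x - a/2)` (affine of slope `-m`). [folklore] -/
theorem q_of_ge {a m x : ℝ} (ha : a < 0) (hx : a / 2 ≤ x) :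
    q a m x = q a m (a / 2) - m * (x - a / 2) := by
  have hint : ∀ b c, IntervalIntegrable (dq a m) volume b c := fun b c ↦
    (contDiff_dq a m).continuous.intervalIntegrable b c
  have h0 : ∫ u in (a / 2)..x, dq a m u = ∫ u in (a / 2)..x, -m := by
    refine integral_congr fun u hu ↦ ?_
    rw [uIcc_of_le hx] at hu
    exact dq_of_ge ha hu.1
  simp only [q]
  rw [← integral_add_adjacent_intervals (hint a (a / 2)) (hint (a / 2) x), h0,
    intervalIntegral.integral_const]
  simp only [smul_eq_mul]
  ring

/-- To the right of `a/2`: `s(t) = s(a/2) + λ (e^{-a/2} - e^{-t})`. [folklore] -/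
theorem sfun_of_ge {a lam t : ℝ} (ha : a < 0) (ht : a / 2 ≤ t) :
    sfun a lam t = sfun a lam (a / 2) + lam * (exp (-(a / 2)) - exp (-t)) := by
  have hint : ∀ b c, IntervalIntegrable (ds a lam) volume b c := fun b c ↦
    (contDiff_ds a lam).continuous.intervalIntegrable b c
  have h0 : ∫ u in (a / 2)..t, ds a lam u = ∫ u in (a / 2)..t, -lam * -exp (-u) := by
    refine integral_congr fun u hu ↦ ?_
    rw [uIcc_of_le ht] at hu
    rw [ds_of_ge ha hu.1]
    ring
  simp only [sfun]
  rw [← integral_add_adjacent_intervals (hint a (a / 2)) (hint (a / 2) t), h0,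
    intervalIntegral.integral_const_mul, integral_neg_exp_neg]
  ring

/-- `p ≥ e^{-a/2}` at `a/2`, hence (monotonicity) the constant `κ = p(a/2)` is positive. [folklore] -/
theorem exp_le_p_half {a : ℝ} (ha : a < 0) : exp (-(a / 2)) ≤ p a (a / 2) := by
  have hle : a ≤ a / 2 := by linarith
  have h1 : ∫ u in a..(a / 2), -exp (-u) ≤ ∫ u in a..(a / 2), dp a u :=
    integral_mono_on hle ((continuous_neg.rexp.neg).intervalIntegrable _ _)
      ((contDiff_dp a).continuous.intervalIntegrable _ _) fun u _ ↦ neg_exp_le_dp a u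
  rw [integral_neg_exp_neg] at h1
  simp only [p]
  linarith

/-- `q(a/2) ≥ e^{-a/2}` (for `m ≤ 1`). [folklore] -/
theorem exp_le_q_half {a m : ℝ} (ha : a < 0) (hm1 : m ≤ 1) : exp (-(a / 2)) ≤ q a m (a / 2) := by
  have hle : a ≤ a / 2 := by linarith
  have h1 : ∫ u in a..(a / 2), -exp (-u) ≤ ∫ u in a..(a / 2), dq a m u :=
    integral_mono_on hle ((continuous_neg.rexp.neg).intervalIntegrable _ _)
      ((contDiff_dq a m).continuous.intervalIntegrable _ _)
      fun u hu ↦ neg_exp_le_dq ha hm1 hu.2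
  rw [integral_neg_exp_neg] at h1
  simp only [q]
  linarith

/-- `p > 0` everywhere: `p` is non-increasing and constant `= p(a/2) ≥ e^{-a/2} > 0` to the right
of `a/2`. [folklore] -/
theorem p_pos {a : ℝ} (ha : a < 0) (x : ℝ) : 0 < p a x := by
  have hκ : 0 < p a (a / 2) := (exp_pos _).trans_le (exp_le_p_half ha)
  rcases le_total x (a / 2) with h | h
  · exact hκ.trans_le (antitone_p a h)
  · rwa [p_of_ge ha h]

/-- The value of `s` at `a/2` is affine in `λ`: `s_λ(a/2) = a + I₁ + λ I₂` with
`I₁ = ∫_a^{a/2} φ`, `I₂ = ∫_a^{a/2} (1 - φ) e^{-u}`. [folklore] -/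
theorem sfun_half_eq (a lam : ℝ) :
    sfun a lam (a / 2) = a + (∫ u in a..(a / 2), cutoff a u) +
      lam * ∫ u in a..(a / 2), (1 - cutoff a u) * exp (-u) := by
  have hc : Continuous (cutoff a) := continuous_cutoff a
  have h2 : Continuous fun u ↦ (1 - cutoff a u) * exp (-u) :=
    (continuous_const.sub hc).mul continuous_neg.rexp
  simp only [sfun, ds]
  rw [integral_add (hc.intervalIntegrable _ _) ((h2.const_mul lam).intervalIntegrable _ _ |>.congr
      (by intro u _; simp only; ring)), add_assoc]
  congr 2
  rw [← intervalIntegral.integral_const_mul]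
  refine integral_congr fun u _ ↦ ?_
  ring

/-! ### The curvature expression of a squared warping function -/

/-- **The convexity expression of `c = (f ∘ s)²` against `c₃ = s'²`** (the quantity
`c''/2 - c'²/(4c) - c₃' c'/(4 c₃)` of `curvatureForm_oneVarMetric_nonpos`) equals
`f(s) f''(s) s'²`: it is `-f f_{ss} · s'²`-free of the reparametrisation, i.e. minus the warping
function times its second ARCLENGTH derivative (O'Neill 1983, Ch. 7, Prop. 7.42: the sectional
curvature `-f''/f` of a warped product). [cite: ONeill1983, Ch. 7, Prop. 7.42] -/
theorem convexityExpr_eq {f f' f'' s s' s'' : ℝ → ℝ}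
    (hf : ∀ x, HasDerivAt f (f' x) x) (hf' : ∀ x, HasDerivAt f' (f'' x) x)
    (hs : ∀ t, HasDerivAt s (s' t) t) (hs' : ∀ t, HasDerivAt s' (s'' t) t) (t : ℝ)
    (hft : f (s t) ≠ 0) (hst : s' t ≠ 0) :
    deriv (deriv (fun t ↦ f (s t) ^ 2)) t / 2
      - deriv (fun t ↦ f (s t) ^ 2) t ^ 2 / (4 * f (s t) ^ 2)
      - deriv (fun t ↦ s' t ^ 2) t * deriv (fun t ↦ f (s t) ^ 2) t / (4 * s' t ^ 2)
      = f (s t) * f'' (s t) * s' t ^ 2 := by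
  -- first derivatives
  have hfs : ∀ t, HasDerivAt (fun t ↦ f (s t)) (f' (s t) * s' t) t := fun t ↦
    (hf (s t)).comp t (hs t)
  have hf's : ∀ t, HasDerivAt (fun t ↦ f' (s t)) (f'' (s t) * s' t) t := fun t ↦
    (hf' (s t)).comp t (hs t)
  have h1 : ∀ t, HasDerivAt (fun t ↦ f (s t) ^ 2) (2 * (f (s t) * (f' (s t) * s' t))) t := by
    intro t
    have := (hfs t).mul (hfs t)
    refine (this.congr_deriv ?_).congr_of_eventuallyEq ?_
    · ring
    · exact Filter.Eventually.of_forall fun u ↦ by simp [sq]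
  have hd1 : deriv (fun t ↦ f (s t) ^ 2) = fun t ↦ 2 * (f (s t) * (f' (s t) * s' t)) :=
    funext fun t ↦ (h1 t).deriv
  have h2 : HasDerivAt (fun t ↦ 2 * (f (s t) * (f' (s t) * s' t)))
      (2 * (f' (s t) * s' t * (f' (s t) * s' t) +
        f (s t) * (f'' (s t) * s' t * s' t + f' (s t) * s'' t))) t :=
    (((hfs t).mul ((hf's t).mul (hs' t)))).const_mul 2
  have h3 : HasDerivAt (fun t ↦ s' t ^ 2) (2 * (s' t * s'' t)) t := by
    have := (hs' t).mul (hs' t)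
    refine (this.congr_deriv ?_).congr_of_eventuallyEq ?_
    · ring
    · exact Filter.Eventually.of_forall fun u ↦ by simp [sq]
  rw [hd1, h2.deriv, h3.deriv]
  field_simp
  ring

/-- The first derivative of `(f ∘ s)²` is `2 f(s) f'(s) s'`. [folklore] -/
theorem deriv_sq_comp_eq {f f' s s' : ℝ → ℝ} (hf : ∀ x, HasDerivAt f (f' x) x)
    (hs : ∀ t, HasDerivAt s (s' t) t) (t : ℝ) :
    deriv (fun t ↦ f (s t) ^ 2) t = 2 * f (s t) * f' (s t) * s' t := by
  have hfs : HasDerivAt (fun t ↦ f (s t)) (f' (s t) * s' t) t := (hf (s t)).comp t (hs t)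
  have := hfs.mul hfs
  have h1 : HasDerivAt (fun t ↦ f (s t) ^ 2) (2 * f (s t) * f' (s t) * s' t) t := by
    refine (this.congr_deriv ?_).congr_of_eventuallyEq ?_
    · ring
    · exact Filter.Eventually.of_forall fun u ↦ by simp [sq]
  exact h1.deriv

/-! ### The profile -/

section Profile

variable {a L : ℝ} (ha : a < 0) (hL : 2 * π ≤ L)

/-- The cone slope `m = 2π / L ∈ (0, 1]`. [folklore] -/
def slope (L : ℝ) : ℝ := 2 * π / L

include hL in
/-- `L > 0`. [folklore] -/
theorem L_pos : 0 < L := lt_of_lt_of_le (by positivity) hL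

include hL in
/-- `0 < m`. [folklore] -/
theorem slope_pos : 0 < slope L := div_pos (by positivity) (L_pos hL)

include hL in
/-- `m ≤ 1` (this is `L ≥ 2π`). [folklore] -/
theorem slope_le_one : slope L ≤ 1 := (div_le_one (L_pos hL)).2 hL

/-- The cone tip `s_* = a/2 + q(a/2)/m` (the zero of the affine part of `q`). [folklore] -/
def sStar (a L : ℝ) : ℝ := a / 2 + q a (slope L) (a / 2) / slope L

/-- The scale `λ = (s_* - a - I₁) / (I₂ + e^{-a/2})` making `s(t) → s_*` as `t → ∞`. [folklore] -/
def lam (a L : ℝ) : ℝ :=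
  (sStar a L - a - ∫ u in a..(a / 2), cutoff a u) /
    ((∫ u in a..(a / 2), (1 - cutoff a u) * exp (-u)) + exp (-(a / 2)))

include ha hL in
/-- `q(a/2) > 0`. [folklore] -/
theorem q_half_pos : 0 < q a (slope L) (a / 2) :=
  (exp_pos _).trans_le (exp_le_q_half ha (slope_le_one hL))

/-- `s_* - a/2 = q(a/2)/m`. [folklore] -/
theorem sStar_sub_half : sStar a L - a / 2 = q a (slope L) (a / 2) / slope L := by
  simp [sStar]

include ha hL in
/-- `s_* > a/2`. [folklore] -/
theorem half_lt_sStar : a / 2 < sStar a L := by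
  have := div_pos (q_half_pos ha hL) (slope_pos hL)
  rw [← sStar_sub_half] at this
  linarith

include ha in
/-- `I₁ = ∫_a^{a/2} φ ≤ -a/2`. [folklore] -/
theorem I₁_le : (∫ u in a..(a / 2), cutoff a u) ≤ -a / 2 := by
  have hle : a ≤ a / 2 := by linarith
  have h := integral_mono_on hle ((continuous_cutoff a).intervalIntegrable (μ := volume) _ _)
    (continuous_const.intervalIntegrable (μ := volume) _ _) fun u _ ↦ cutoff_le_one a u
  rw [intervalIntegral.integral_const] at h
  simp only [smul_eq_mul, mul_one] at h
  linarith

include ha in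
/-- `I₂ = ∫_a^{a/2} (1 - φ) e^{-u} ≥ 0`. [folklore] -/
theorem I₂_nonneg : 0 ≤ ∫ u in a..(a / 2), (1 - cutoff a u) * exp (-u) :=
  integral_nonneg (by linarith) fun u _ ↦
    mul_nonneg (by linarith [cutoff_le_one a u]) (exp_pos _).le

include ha hL in
/-- `λ > 0`. [folklore] -/
theorem lam_pos : 0 < lam a L := by
  refine div_pos ?_ (add_pos_of_nonneg_of_pos (I₂_nonneg ha) (exp_pos _))
  have h1 := I₁_le ha
  have h2 := half_lt_sStar ha hL
  linarith

include ha in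
/-- The ends meet: `s(a/2) + λ e^{-a/2} = s_*`. [folklore] -/
theorem sfun_half_add : sfun a (lam a L) (a / 2) + lam a L * exp (-(a / 2)) = sStar a L := by
  rw [sfun_half_eq]
  have hden : (∫ u in a..(a / 2), (1 - cutoff a u) * exp (-u)) + exp (-(a / 2)) ≠ 0 :=
    (add_pos_of_nonneg_of_pos (I₂_nonneg ha) (exp_pos _)).ne'
  have key : lam a L * ((∫ u in a..(a / 2), (1 - cutoff a u) * exp (-u)) + exp (-(a / 2))) =
      sStar a L - a - ∫ u in a..(a / 2), cutoff a u := by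
    simp only [lam]
    field_simp
  linarith [key]

include ha in
/-- To the right of `a/2`: `s(t) = s_* - λ e^{-t}`. [folklore] -/
theorem sfun_of_ge' {t : ℝ} (ht : a / 2 ≤ t) : sfun a (lam a L) t = sStar a L - lam a L * exp (-t) := by
  rw [sfun_of_ge ha ht, ← sfun_half_add ha]
  ring

include ha hL in
/-- `s(t) < s_*` for all `t`. [folklore] -/
theorem sfun_lt_sStar (t : ℝ) : sfun a (lam a L) t < sStar a L := by
  have hl := lam_pos ha hL
  rcases le_total (a / 2) t with h | h
  · rw [sfun_of_ge' ha h]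
    have := mul_pos hl (exp_pos (-t))
    linarith
  · have hmono := (strictMono_sfun (a := a) hl).monotone h
    rw [sfun_of_ge' ha le_rfl] at hmono
    have := mul_pos hl (exp_pos (-(a / 2)))
    linarith

include ha hL in
/-- `q(s_*) = 0`. [folklore] -/
theorem q_sStar : q a (slope L) (sStar a L) = 0 := by
  rw [q_of_ge ha (half_lt_sStar ha hL).le, sStar_sub_half]
  have := (slope_pos hL).ne'
  field_simp
  ring

include ha hL in
/-- `q(s(t)) > 0` for all `t` (`q` is strictly decreasing with zero at `s_* > s(t)`). [folklore] -/
theorem q_sfun_pos (t : ℝ) : 0 < q a (slope L) (sfun a (lam a L) t) := by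
  have := strictAnti_q (a := a) (slope_pos hL) (sfun_lt_sStar ha hL t)
  rwa [q_sStar ha hL] at this

/-- The threshold `T = max (a/2, log (λ / (s_* - a/2)))` beyond which `s(t) ≥ a/2`, so that the
profile has reached its final (flat-cone) form. [folklore] -/
def T (a L : ℝ) : ℝ := max (a / 2) (Real.log (lam a L / (sStar a L - a / 2)))

/-- `T ≥ a/2`. [folklore] -/
theorem half_le_of_T_le {t : ℝ} (ht : T a L ≤ t) : a / 2 ≤ t := (le_max_left _ _).trans ht

include ha hL in
/-- For `t ≥ T`: `s(t) ≥ a/2`. [folklore] -/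
theorem half_le_sfun_of_T_le {t : ℝ} (ht : T a L ≤ t) : a / 2 ≤ sfun a (lam a L) t := by
  have hD : 0 < sStar a L - a / 2 := by linarith [half_lt_sStar ha hL]
  have hl := lam_pos ha hL
  have ht' : Real.log (lam a L / (sStar a L - a / 2)) ≤ t := (le_max_right _ _).trans ht
  have h1 : exp (-t) ≤ (sStar a L - a / 2) / lam a L := by
    have := Real.exp_le_exp.2 (neg_le_neg ht')
    rwa [Real.exp_neg (Real.log _), Real.exp_log (div_pos hl hD), inv_div] at this
  have h2 : lam a L * exp (-t) ≤ sStar a L - a / 2 := by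
    have := mul_le_mul_of_nonneg_left h1 hl.le
    rwa [mul_div_cancel₀ _ hl.ne'] at this
  rw [sfun_of_ge' ha (half_le_of_T_le ht)]
  linarith

include ha hL in
/-- On the final region: `q(s(t)) = m λ e^{-t}` (the cone of slope `-m` seen through
`s = s_* - λ e^{-t}`). [folklore] -/
theorem q_sfun_of_T_le {t : ℝ} (ht : T a L ≤ t) :
    q a (slope L) (sfun a (lam a L) t) = slope L * (lam a L * exp (-t)) := by
  rw [q_of_ge ha (half_le_sfun_of_T_le ha hL ht), sfun_of_ge' ha (half_le_of_T_le ht)]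
  have hm := (slope_pos hL).ne'
  simp only [sStar]
  field_simp
  ring

include ha hL in
/-- On the final region: `p(s(t)) = κ = p(a/2)`. [folklore] -/
theorem p_sfun_of_T_le {t : ℝ} (ht : T a L ≤ t) : p a (sfun a (lam a L) t) = p a (a / 2) :=
  p_of_ge ha (half_le_sfun_of_T_le ha hL ht)

/-! ### Second derivatives of `p`, `q` are non-negative (convexity) -/

/-- `p'' (x) = e^{-x} (φ(x) - φ'(x))`. [folklore] -/
theorem hasDerivAt_dp (a x : ℝ) :
    HasDerivAt (dp a) (-(deriv (cutoff a) x * exp (-x) + cutoff a x * (exp (-x) * -1))) x := by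
  have h := ((hasDerivAt_cutoff a x).mul ((hasDerivAt_neg x).exp)).neg
  exact h

/-- `q''(x) = φ(x) e^{-x} - φ'(x) (e^{-x} - m)`. [folklore] -/
theorem hasDerivAt_dq (a m x : ℝ) :
    HasDerivAt (dq a m) (-(deriv (cutoff a) x * exp (-x) + cutoff a x * (exp (-x) * -1) +
      (-deriv (cutoff a) x) * m)) x := by
  have h1 := (hasDerivAt_cutoff a x).mul ((hasDerivAt_neg x).exp)
  have h2 := ((hasDerivAt_cutoff a x).const_sub 1).mul_const m
  exact (h1.add h2).neg

/-- `p'' ≥ 0`: `p` is convex. [folklore] -/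
theorem deriv_dp_nonneg {a : ℝ} (ha : a < 0) (x : ℝ) : 0 ≤ deriv (dp a) x := by
  rw [(hasDerivAt_dp a x).deriv]
  have h1 := deriv_cutoff_nonpos ha x
  have h2 := cutoff_nonneg a x
  have h3 := exp_pos (-x)
  nlinarith

/-- `q'' ≥ 0` (for `m ≤ 1`): `q` is convex — on the transition region `x ≤ a/2 < 0` one has
`e^{-x} ≥ 1 ≥ m`, and to the right of it `φ' = 0`. [folklore] -/
theorem deriv_dq_nonneg {a m : ℝ} (ha : a < 0) (hm1 : m ≤ 1) (x : ℝ) : 0 ≤ deriv (dq a m) x := by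
  rw [(hasDerivAt_dq a m x).deriv]
  have h1 := deriv_cutoff_nonpos ha x
  have h2 := cutoff_nonneg a x
  have h3 := exp_pos (-x)
  rcases le_or_gt x (a / 2) with hx | hx
  · have hmx : m ≤ exp (-x) := hm1.trans (by
      have : 0 ≤ -x := by linarith
      simpa using (one_le_exp this))
    nlinarith
  · rw [deriv_cutoff_of_gt ha hx]
    nlinarith

/-! ### The profile -/

/-- The constant `κ = p(a/2) > 0` of the `T²`-directions near the core. [folklore] -/
def kappa (a : ℝ) : ℝ := p a (a / 2)

include ha in
/-- `κ > 0`. [folklore] -/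
theorem kappa_pos : 0 < kappa a := p_pos ha _

/-- `c₀ = c₁ = p(s(t))²`. [folklore] -/
def c0 (a L : ℝ) (t : ℝ) : ℝ := p a (sfun a (lam a L) t) ^ 2

/-- `c₂ = q(s(t))²`. [folklore] -/
def c2 (a L : ℝ) (t : ℝ) : ℝ := q a (slope L) (sfun a (lam a L) t) ^ 2

/-- `c₃ = s'(t)²`. [folklore] -/
def c3 (a L : ℝ) (t : ℝ) : ℝ := ds a (lam a L) t ^ 2

/-- **The profile** `c = (c₀, c₀, c₂, c₃)` of the smoothed cusp metric
`c₀ (dy₀² + dy₁²) + c₂ dy₂² + c₃ dt²`. [cite: Anderson2006, §2.1] -/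
def c (a L : ℝ) : Fin 4 → ℝ → ℝ := ![c0 a L, c0 a L, c2 a L, c3 a L]

/-- The entry `c 0 = c₀`. [folklore] -/
@[simp] theorem c_zero : c a L 0 = c0 a L := rfl

/-- The entry `c 1 = c₀`. [folklore] -/
@[simp] theorem c_one : c a L 1 = c0 a L := rfl

/-- The entry `c 2 = c₂`. [folklore] -/
@[simp] theorem c_two : c a L 2 = c2 a L := rfl

/-- The entry `c 3 = c₃`. [folklore] -/
@[simp] theorem c_three : c a L 3 = c3 a L := rfl

/-- The entries other than `c₃` are `c₀` or `c₂`. [folklore] -/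
theorem c_eq_or (i : Fin 4) (hi : i ≠ 3) : c a L i = c0 a L ∨ c a L i = c2 a L := by
  fin_cases i
  · exact Or.inl rfl
  · exact Or.inl rfl
  · exact Or.inr rfl
  · exact absurd rfl hi

/-- Smoothness of the profile. [folklore] -/
theorem contDiff_c (i : Fin 4) : ContDiff ℝ ∞ (c a L i) := by
  have h0 : ContDiff ℝ ∞ (c0 a L) := ((contDiff_p a).comp (contDiff_sfun a _)).pow 2
  have h2 : ContDiff ℝ ∞ (c2 a L) := ((contDiff_q a _).comp (contDiff_sfun a _)).pow 2
  have h3 : ContDiff ℝ ∞ (c3 a L) := (contDiff_ds a _).pow 2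
  fin_cases i <;> assumption

include ha hL in
/-- Positivity of the profile. [folklore] -/
theorem c_pos (i : Fin 4) (t : ℝ) : 0 < c a L i t := by
  have h0 : 0 < c0 a L t := pow_pos (p_pos ha _) 2
  have h2 : 0 < c2 a L t := pow_pos (q_sfun_pos ha hL t) 2
  have h3 : 0 < c3 a L t := pow_pos (ds_pos (lam_pos ha hL) t) 2
  fin_cases i <;> assumption

include ha in
/-- **Hyperbolic form for `t ≤ a`**: `c₀ = c₁ = c₂ = e^{-2t}`, `c₃ = 1`. [folklore] -/
theorem c_of_le {t : ℝ} (ht : t ≤ a) :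
    c a L 0 t = exp (-2 * t) ∧ c a L 1 t = exp (-2 * t) ∧ c a L 2 t = exp (-2 * t) ∧
      c a L 3 t = 1 := by
  have hs : sfun a (lam a L) t = t := sfun_of_le ha ht
  have he : exp (-t) ^ 2 = exp (-2 * t) := by rw [sq, ← Real.exp_add]; ring_nf
  have h0 : c0 a L t = exp (-2 * t) := by rw [c0, hs, p_of_le ha ht, he]
  have h2 : c2 a L t = exp (-2 * t) := by rw [c2, hs, q_of_le ha ht, he]
  have h3 : c3 a L t = 1 := by rw [c3, ds_of_le ha ht]; norm_num
  exact ⟨h0, h0, h2, h3⟩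

include ha hL in
/-- **Flat-cone form for `t ≥ T`**: `c₀ = c₁ = κ²`, `c₂ = λ² m² e^{-2t}`, `c₃ = λ² e^{-2t}`.
[folklore] -/
theorem c_of_T_le {t : ℝ} (ht : T a L ≤ t) :
    c a L 0 t = kappa a ^ 2 ∧ c a L 1 t = kappa a ^ 2 ∧
      c a L 2 t = lam a L ^ 2 * slope L ^ 2 * exp (-2 * t) ∧
      c a L 3 t = lam a L ^ 2 * exp (-2 * t) := by
  have he : exp (-t) ^ 2 = exp (-2 * t) := by rw [sq, ← Real.exp_add]; ring_nf
  have h0 : c0 a L t = kappa a ^ 2 := by rw [c0, p_sfun_of_T_le ha hL ht, kappa]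
  have h2 : c2 a L t = lam a L ^ 2 * slope L ^ 2 * exp (-2 * t) := by
    rw [c2, q_sfun_of_T_le ha hL ht, ← he]; ring
  have h3 : c3 a L t = lam a L ^ 2 * exp (-2 * t) := by
    rw [c3, ds_of_ge ha (half_le_of_T_le ht), ← he]; ring
  exact ⟨h0, h0, h2, h3⟩

include ha hL in
/-- The convexity expression of `c₀` is `p(s) p''(s) s'² ≥ 0`. [folklore] -/
theorem convexityExpr_c0_nonneg (t : ℝ) :
    0 ≤ deriv (deriv (c0 a L)) t / 2 - deriv (c0 a L) t ^ 2 / (4 * c0 a L t)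
      - deriv (c3 a L) t * deriv (c0 a L) t / (4 * c3 a L t) := by
  have hl := lam_pos ha hL
  have h := convexityExpr_eq (f := p a) (f' := dp a) (f'' := deriv (dp a))
    (s := sfun a (lam a L)) (s' := ds a (lam a L)) (s'' := deriv (ds a (lam a L)))
    (hasDerivAt_p a) (fun x ↦ (hasDerivAt_dp a x).differentiableAt.hasDerivAt)
    (hasDerivAt_sfun a _)
    (fun t ↦ (((contDiff_ds a _).differentiable (by simp)).differentiableAt).hasDerivAt) t
    (p_pos ha _).ne' (ds_pos hl t).ne'
  change 0 ≤ deriv (deriv (fun t ↦ p a (sfun a (lam a L) t) ^ 2)) t / 2 -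
    deriv (fun t ↦ p a (sfun a (lam a L) t) ^ 2) t ^ 2 / (4 * p a (sfun a (lam a L) t) ^ 2) -
    deriv (fun t ↦ ds a (lam a L) t ^ 2) t * deriv (fun t ↦ p a (sfun a (lam a L) t) ^ 2) t /
      (4 * ds a (lam a L) t ^ 2)
  rw [h]
  exact mul_nonneg (mul_nonneg (p_pos ha _).le (deriv_dp_nonneg ha _)) (sq_nonneg _)

include ha hL in
/-- The convexity expression of `c₂` is `q(s) q''(s) s'² ≥ 0`. [folklore] -/
theorem convexityExpr_c2_nonneg (t : ℝ) :
    0 ≤ deriv (deriv (c2 a L)) t / 2 - deriv (c2 a L) t ^ 2 / (4 * c2 a L t)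
      - deriv (c3 a L) t * deriv (c2 a L) t / (4 * c3 a L t) := by
  have hl := lam_pos ha hL
  have h := convexityExpr_eq (f := q a (slope L)) (f' := dq a (slope L))
    (f'' := deriv (dq a (slope L)))
    (s := sfun a (lam a L)) (s' := ds a (lam a L)) (s'' := deriv (ds a (lam a L)))
    (hasDerivAt_q a _) (fun x ↦ (hasDerivAt_dq a _ x).differentiableAt.hasDerivAt)
    (hasDerivAt_sfun a _)
    (fun t ↦ (((contDiff_ds a _).differentiable (by simp)).differentiableAt).hasDerivAt) t
    (q_sfun_pos ha hL t).ne' (ds_pos hl t).ne'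
  change 0 ≤ deriv (deriv (fun t ↦ q a (slope L) (sfun a (lam a L) t) ^ 2)) t / 2 -
    deriv (fun t ↦ q a (slope L) (sfun a (lam a L) t) ^ 2) t ^ 2 /
      (4 * q a (slope L) (sfun a (lam a L) t) ^ 2) -
    deriv (fun t ↦ ds a (lam a L) t ^ 2) t *
      deriv (fun t ↦ q a (slope L) (sfun a (lam a L) t) ^ 2) t / (4 * ds a (lam a L) t ^ 2)
  rw [h]
  exact mul_nonneg (mul_nonneg (q_sfun_pos ha hL t).le
    (deriv_dq_nonneg ha (slope_le_one hL) _)) (sq_nonneg _)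

include ha hL in
/-- `c₀' = 2 p p' s' ≤ 0`. [folklore] -/
theorem deriv_c0_nonpos (t : ℝ) : deriv (c0 a L) t ≤ 0 := by
  change deriv (fun t ↦ p a (sfun a (lam a L) t) ^ 2) t ≤ 0
  rw [deriv_sq_comp_eq (hasDerivAt_p a) (hasDerivAt_sfun a _)]
  have h1 := p_pos ha (sfun a (lam a L) t)
  have h2 := dp_nonpos a (sfun a (lam a L) t)
  have h3 := ds_pos (a := a) (lam_pos ha hL) t
  have : 0 ≤ 2 * p a (sfun a (lam a L) t) * (-dp a (sfun a (lam a L) t)) * ds a (lam a L) t :=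
    mul_nonneg (mul_nonneg (mul_nonneg zero_le_two h1.le) (neg_nonneg.2 h2)) h3.le
  linarith

include ha hL in
/-- `c₂' = 2 q q' s' ≤ 0`. [folklore] -/
theorem deriv_c2_nonpos (t : ℝ) : deriv (c2 a L) t ≤ 0 := by
  change deriv (fun t ↦ q a (slope L) (sfun a (lam a L) t) ^ 2) t ≤ 0
  rw [deriv_sq_comp_eq (hasDerivAt_q a _) (hasDerivAt_sfun a _)]
  have h1 := q_sfun_pos ha hL t
  have h2 := dq_nonpos (a := a) (slope_pos hL) (sfun a (lam a L) t)
  have h3 := ds_pos (a := a) (lam_pos ha hL) t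
  have : 0 ≤ 2 * q a (slope L) (sfun a (lam a L) t) * (-dq a (slope L) (sfun a (lam a L) t)) *
      ds a (lam a L) t :=
    mul_nonneg (mul_nonneg (mul_nonneg zero_le_two h1.le) (neg_nonneg.2 h2)) h3.le
  linarith

include ha hL in
/-- `cᵢ' ≤ 0` for `i ≠ 3`. [folklore] -/
theorem deriv_c_nonpos (i : Fin 4) (hi : i ≠ 3) (t : ℝ) : deriv (c a L i) t ≤ 0 := by
  rcases c_eq_or i hi with h | h <;> rw [h]
  · exact deriv_c0_nonpos ha hL t
  · exact deriv_c2_nonpos ha hL t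

include ha hL in
/-- **The convexity conditions** of `curvatureForm_oneVarMetric_nonpos` hold for the profile.
[cite: ONeill1983, Ch. 7, Prop. 7.42] -/
theorem convexity_c (t : ℝ) (i : Fin 4) (hi : i ≠ 3) :
    0 ≤ deriv (deriv (c a L i)) t / 2 - deriv (c a L i) t ^ 2 / (4 * c a L i t)
      - deriv (c a L 3) t * deriv (c a L i) t / (4 * c a L 3 t) := by
  rcases c_eq_or i hi with h | h <;> rw [h, c_three]
  · exact convexityExpr_c0_nonneg ha hL t
  · exact convexityExpr_c2_nonneg ha hL t

include ha hL in
/-- **The monotonicity conditions** of `curvatureForm_oneVarMetric_nonpos` hold for the profile: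
all warping functions decrease towards the core, so `cᵢ' cⱼ' ≥ 0`. [cite: ONeill1983, Ch. 7, Prop. 7.42] -/
theorem monotonicity_c (t : ℝ) (i j : Fin 4) (hi : i ≠ 3) (hj : j ≠ 3) :
    0 ≤ deriv (c a L i) t * deriv (c a L j) t :=
  mul_nonneg_of_nonpos_of_nonpos (deriv_c_nonpos ha hL i hi t) (deriv_c_nonpos ha hL j hj t)

end Profile

/-- **The smoothing profile of the `2π` theorem.** For every `a < 0` and every slope length
`L ≥ 2π` there are smooth positive functions `c₀, c₁, c₂, c₃ : ℝ → ℝ` and constants `κ, λ > 0`,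
`T` such that the one-variable diagonal metric `c₀ dy₀² + c₁ dy₁² + c₂ dy₂² + c₃ dt²`
(`oneVarMetric`, `OneVariableDiagonalMetric.lean`)
* is the hyperbolic cusp metric `e^{-2t}(dy₀² + dy₁² + dy₂²) + dt²` for `t ≤ a`;
* is the flat metric `κ²(dy₀² + dy₁²) + λ²((2π/L)² e^{-2t} dy₂² + e^{-2t} dt²)` — in the polar
  coordinate `r = e^{-t}`, `λ²(dr² + r² dθ₃²) + κ²(dy₀² + dy₁²)` with `θ₃ = 2π y₂/L` of period `2π`
  when `y₂` has period `L` — for `t ≥ T`;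
* satisfies everywhere the convexity and monotonicity hypotheses of
  `curvatureForm_oneVarMetric_nonpos` (hence has nonpositive sectional curvature).
This is the "natural smoothing of the cone singularity" of Anderson 2006, §2.1 (cone angle
`L e^{-a'} > 2π` on the enlarged cusp torus, which is why `a < 0` is needed when `L = 2π`), in the
warped-product form of Bleiler–Hodgson 1996, proof of Thm. 9. [cite: Anderson2006, §2.1, (2.4)] -/
theorem exists_profile {a L : ℝ} (ha : a < 0) (hL : 2 * π ≤ L) :
    ∃ (c : Fin 4 → ℝ → ℝ) (κ lam T : ℝ), 0 < κ ∧ 0 < lam ∧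
      (∀ i, ContDiff ℝ ∞ (c i)) ∧ (∀ i t, 0 < c i t) ∧
      (∀ t, t ≤ a → c 0 t = exp (-2 * t) ∧ c 1 t = exp (-2 * t) ∧ c 2 t = exp (-2 * t) ∧
        c 3 t = 1) ∧
      (∀ t, T ≤ t → c 0 t = κ ^ 2 ∧ c 1 t = κ ^ 2 ∧
        c 2 t = lam ^ 2 * (2 * π / L) ^ 2 * exp (-2 * t) ∧ c 3 t = lam ^ 2 * exp (-2 * t)) ∧
      (∀ (t : ℝ) (i : Fin 4), i ≠ 3 →
        0 ≤ deriv (deriv (c i)) t / 2 - deriv (c i) t ^ 2 / (4 * c i t)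
          - deriv (c 3) t * deriv (c i) t / (4 * c 3 t)) ∧
      (∀ (t : ℝ) (i j : Fin 4), i ≠ 3 → j ≠ 3 → i ≠ j → 0 ≤ deriv (c i) t * deriv (c j) t) :=
  ⟨c a L, kappa a, lam a L, T a L, kappa_pos ha, lam_pos ha hL, contDiff_c, c_pos ha hL,
    fun _ ht ↦ c_of_le ha ht, fun _ ht ↦ c_of_T_le ha hL ht,
    fun t i hi ↦ convexity_c ha hL t i hi, fun t i j hi hj _ ↦ monotonicity_c ha hL t i j hi hj⟩

end TwoPiProfile

end Literature.Geometry.Riemannian
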